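import Summits.ABC.StewartYu.ArchG3KStepCore
import HarnessLib

/-!
# Cell abc-stewartyu, rung A1.L, WP-L.A parcel P-A5: the ARCHIMEDEAN k-step — the Liouville conclusion at the new integer points

`Summits/ABC/StewartYu/ArchG3KStep.lean` — sequel to `ArchG3KStepCore.lean` (cell `abc-stewartyu`, HOME
`run/shared/lean/pub/abc-stewartyu/`; TRANCHE PLAN v1.2 §4′ row P-A5; seat lp-1).  Theorems only; no definition, no named fact.
The archimedean twin of the cell's `p`-adic k-step `G3Setup.g3_kstep_pm` / `g3_kstep_pm_oddNodes` (`PadicG3KStepPhi`,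
`PadicG3KStepPhiOdd`), in ABSTRACT-VALUES form: besides the `d/dz`-closed family `F : Tau n → ℂ → ℂ` of entire functions
(the `Λ`-free auxiliary functions `f_τ` of Nesterenko 2003 (4.16)–(4.17)) one is given

* the RATIONAL VALUES `φ τ x ∈ ℚ` of the exact auxiliary functions at the integer points (the frame's `g3φ`), with the
  `f − φ` COMPARISON `‖F τ (x) − φ τ x‖ ≤ ε_c` at the integers of the working range (Nesterenko's `f = f₁ + f₂`, (4.10)–(4.11):
  `ε_c` carries the small factor `|Λ|`; Cijsouw–Waldschmidt's Lemma 9 / the cell's `norm_g3F_sub_g3Φ_le`),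
* DENOMINATORS `D x τ ≥ 1` with `D x τ · φ τ x ∈ ℤ` (the frame: `den₀ · |b_{j₀}|^{|τ'|} · monDen`),

and concludes, from the zeros `φ τ'' x = 0` at the nodes (`|τ''| < Tlo`), the growth bound `‖e^{γz} F τ z‖ ≤ B_G` on the big
disc and the numerical inequality `hfinal` («extrapolated bound + ε_c < 1/D»), that `φ τ x₁ = 0` at the NEW points `x₁` for
`|τ| + t ≤ Tlo`: the product formula over `ℚ` in its trivial form `q ∈ ℚ, D·q ∈ ℤ, |q| < 1/D ⇒ q = 0` (Waldschmidt 1980 (3.21)).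

* `kstep_symm` — nodes `|x| ≤ N` → new points `|x₁| ≤ N′ ≤ 3N + 2` (Nesterenko's `𝒳_{s,ν} → 𝒳_{s,ν+1}`, `ν ≥ 1`, and `𝒳_{0,0}`);
* `kstep_odd` — odd nodes `|x| ≤ 2m − 1` → new points `|x₁| ≤ N′ ≤ 6m` (Nesterenko's `𝒳_{s,0} → 𝒳_{s,1}`).

WHAT THIS IS NOT: not the archimedean family itself nor its sizes (`ε_c`, `B_G`, `D` in terms of the record — parcels P-A4/P-A8),
not the level invariant (`ArchLvInv`, after the plan fixes its fields); no crux moves.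

## References
* Yu. V. Nesterenko, LNM 1819 (2003) — §4.1 Lemma 4.2 (4.10)–(4.11), §4.2 Lemma 4.3, (4.24)–(4.35) (the induction on
  `(s, ν)` and the Liouville step at the new points). [Nesterenko2003]
* M. Waldschmidt, Acta Arith. 37 (1980) — Lemma 3.4 (3.21), Lemma 3.6 (the tree's `w80_kstep`, the model). [Waldschmidt1980]
* K. Yu, Acta Math. 211 (2013) — Lemma 5.2 (the `p`-adic model `g3_kstep_pm`). [Yu2013]
-/

noncomputable section

open Finset Real
open Literature.NumberTheory.Transcendental
open Literature.NumberTheory.Transcendental.CW77.Setup (Tau tauNorm bumpτ tauNorm_bumpτ)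

namespace Summit.ABC.StewartYu

namespace ArchKStep

variable {n : ℕ}

/-! ### The Liouville inequality over `ℚ` at an integer point (trivial form of the product formula) -/

/-- **A rational number with a known denominator multiple `D ≥ 1` and absolute value `< 1/D` vanishes.**
[cite: Waldschmidt1980, Lemma 3.4 (3.21)] -/
theorem rat_eq_zero_of_abs_lt {q : ℚ} {D : ℕ} (hD : 1 ≤ D) (hz : ∃ z : ℤ, (D : ℚ) * q = z)
    (hlt : |(q : ℝ)| < 1 / (D : ℝ)) : q = 0 := by
  obtain ⟨z, hz⟩ := hz
  by_contra hne
  have hD0 : (0 : ℝ) < D := by exact_mod_cast (show 0 < D by omega)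
  have hz0 : z ≠ 0 := by
    rintro rfl
    rw [Int.cast_zero, mul_eq_zero] at hz
    rcases hz with h0 | h0
    · exact absurd (by exact_mod_cast h0 : D = 0) (by omega)
    · exact hne h0
  have hz1 : (1 : ℝ) ≤ |(z : ℝ)| := by exact_mod_cast Int.one_le_abs hz0
  have hq : (q : ℝ) = (z : ℝ) / (D : ℝ) := by
    have h' : (D : ℝ) * (q : ℝ) = (z : ℝ) := by exact_mod_cast hz
    field_simp; linarith
  have hge : 1 / (D : ℝ) ≤ |(q : ℝ)| := by
    rw [hq, abs_div, abs_of_pos hD0]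
    exact div_le_div_of_nonneg_right hz1 hD0.le
  linarith

/-- From `‖F − φ‖ ≤ ε_c` and `‖F‖ ≤ A`: `|φ| ≤ A + ε_c` (real absolute value of the rational value). [folklore] -/
private theorem abs_ratCast_le_of_norm_sub_le {u : ℂ} {q : ℚ} {A εc : ℝ} (hA : ‖u‖ ≤ A)
    (hcmp : ‖u - ((q : ℚ) : ℂ)‖ ≤ εc) : |(q : ℝ)| ≤ A + εc := by
  have h1 : ‖((q : ℚ) : ℂ)‖ ≤ ‖u‖ + ‖u - ((q : ℚ) : ℂ)‖ := by
    calc ‖((q : ℚ) : ℂ)‖ = ‖u - (u - ((q : ℚ) : ℂ))‖ := by rw [sub_sub_cancel]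
      _ ≤ ‖u‖ + ‖u - ((q : ℚ) : ℂ)‖ := norm_sub_le u (u - ((q : ℚ) : ℂ))
  have h2 : ‖((q : ℚ) : ℂ)‖ = |(q : ℝ)| := by
    rw [← Complex.ofReal_ratCast, Complex.norm_real, Real.norm_eq_abs]
  rw [← h2]; linarith

/-! ### The k-step at the symmetric nodes -/

/-- **The archimedean k-step, symmetric nodes** (twin of `G3Setup.g3_kstep_pm`; Nesterenko's `𝒳_{s,ν} → 𝒳_{s,ν+1}`).
Data: a `d/dz`-closed family `F` of entire functions (`deriv (F τ) = Σᵢ c τ i · F (τ+eᵢ)`, `Σᵢ‖c τ i‖ ≤ Cs`, `Cs ≥ 1` for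
`|τ| < Tlo`), a twist `γ`, a radius ratio `E ≥ 1`, rational values `φ τ x` with the comparison `‖F τ (x) − φ τ x‖ ≤ ε_c` for
`|x| ≤ 3N+2`, `|τ| ≤ Tlo`, denominators `D x τ ≥ 1` (`D·φ ∈ ℤ`).  Hypotheses: zeros `φ τ'' x = 0` for `|x| ≤ N`, `|τ''| < Tlo`;
growth `‖e^{γz} F τ z‖ ≤ B_G` on `‖z‖ ≤ (3E+1)(2N+1) + N` for `|τ| + t ≤ Tlo`; and at every new point `|x₁| ≤ N′ ≤ 3N+2`,
`|τ| + t ≤ Tlo`: `e^{‖γ‖N′}·(2(2N+1)^{t+1} t (20e)^{(2N+1)t} ((1+‖γ‖)Cs)ᵗ e^{‖γ‖N} ε_c + B_G E^{−(2N+1)t}) + ε_c < 1/D x₁ τ`.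
Conclusion: `φ τ x₁ = 0` for `|x₁| ≤ N′`, `|τ| + t ≤ Tlo`.
[cite: Nesterenko2003, §4.2 Lemma 4.3, (4.24)–(4.35)] [cite: Waldschmidt1980, Lemma 3.6] [cite: Yu2013, Lemma 5.2] -/
theorem kstep_symm (F : Tau n → ℂ → ℂ) (c : Tau n → Fin (n + 1) → ℂ)
    (hdiff : ∀ τ, Differentiable ℂ (F τ)) (hode : ∀ τ z, deriv (F τ) z = ∑ i, c τ i * F (bumpτ τ i) z)
    {Tlo : ℕ} {Cs : ℝ} (hCs1 : 1 ≤ Cs) (hc : ∀ τ, tauNorm τ < Tlo → ∑ i, ‖c τ i‖ ≤ Cs)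
    (γ : ℂ) {N N' t : ℕ} (hN' : N' ≤ 3 * N + 2) (ht : 1 ≤ t) {εc BG E : ℝ} (hεc0 : 0 ≤ εc) (hE : 1 ≤ E)
    (φ : Tau n → ℤ → ℚ)
    (hcmp : ∀ x : ℤ, |x| ≤ 3 * (N : ℤ) + 2 → ∀ τ' : Tau n, tauNorm τ' ≤ Tlo → ‖F τ' (x : ℂ) - ((φ τ' x : ℚ) : ℂ)‖ ≤ εc)
    (hzero : ∀ x : ℤ, |x| ≤ (N : ℤ) → ∀ τ'' : Tau n, tauNorm τ'' < Tlo → φ τ'' x = 0)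
    (hBG : ∀ τ : Tau n, tauNorm τ + t ≤ Tlo →
      ∀ z : ℂ, ‖z‖ ≤ (3 * E + 1) * (2 * N + 1) + N → ‖Complex.exp (γ * z) * F τ z‖ ≤ BG)
    (D : ℤ → Tau n → ℕ) (hD : ∀ x τ, 1 ≤ D x τ) (hden : ∀ x τ, ∃ z : ℤ, (D x τ : ℚ) * φ τ x = z)
    (hfinal : ∀ x₁ : ℤ, |x₁| ≤ (N' : ℤ) → ∀ τ : Tau n, tauNorm τ + t ≤ Tlo →
      Real.exp (‖γ‖ * N') *
          (2 * ((2 * N + 1 : ℕ) : ℝ) ^ (t + 1) * t * (20 * Real.exp 1) ^ ((2 * N + 1) * t) *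
              (((1 + ‖γ‖) * Cs) ^ t * Real.exp (‖γ‖ * N) * εc) +
            BG * (1 / E) ^ ((2 * N + 1) * t)) + εc < 1 / (D x₁ τ : ℝ)) :
    ∀ x₁ : ℤ, |x₁| ≤ (N' : ℤ) → ∀ τ : Tau n, tauNorm τ + t ≤ Tlo → φ τ x₁ = 0 := by
  intro x₁ hx₁ τ hτ
  -- approximate zeros of `F` at the nodes
  have hsmall : ∀ x : ℤ, |x| ≤ (N : ℤ) → ∀ τ'' : Tau n, tauNorm τ'' < Tlo → ‖F τ'' (x : ℂ)‖ ≤ εc := by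
    intro x hx τ'' hτ''
    have h := hcmp x (by omega) τ'' hτ''.le
    rwa [hzero x hx τ'' hτ'', Rat.cast_zero, sub_zero] at h
  -- the extrapolated bound at the new point
  have hx₁n : ‖((x₁ : ℤ) : ℂ)‖ ≤ 3 * N + 2 := by
    rw [Complex.norm_intCast]
    have : (|x₁| : ℝ) ≤ N' := by exact_mod_cast hx₁
    have : ((N' : ℕ) : ℝ) ≤ 3 * N + 2 := by exact_mod_cast hN'
    linarith
  have hF := norm_le_of_small_values_symm F c hdiff hode hCs1 hc γ N ht hεc0 hE hsmall τ hτ (hBG τ hτ) hx₁n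
  set A : ℝ := 2 * ((2 * N + 1 : ℕ) : ℝ) ^ (t + 1) * t * (20 * Real.exp 1) ^ ((2 * N + 1) * t) *
      (((1 + ‖γ‖) * Cs) ^ t * Real.exp (‖γ‖ * N) * εc) + BG * (1 / E) ^ ((2 * N + 1) * t) with hA
  have hA0 : 0 ≤ A := by
    have hBG0 : 0 ≤ BG := le_trans (norm_nonneg _) (hBG τ hτ 0 (by simp; positivity))
    positivity
  have hexp : Real.exp (‖γ‖ * ‖((x₁ : ℤ) : ℂ)‖) ≤ Real.exp (‖γ‖ * N') := by
    refine Real.exp_le_exp.mpr (mul_le_mul_of_nonneg_left ?_ (norm_nonneg _))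
    rw [Complex.norm_intCast]; exact_mod_cast hx₁
  have hF' : ‖F τ ((x₁ : ℤ) : ℂ)‖ ≤ Real.exp (‖γ‖ * N') * A :=
    hF.trans (mul_le_mul_of_nonneg_right hexp hA0)
  -- the rational value is small, hence zero
  have hφ : |((φ τ x₁ : ℚ) : ℝ)| ≤ Real.exp (‖γ‖ * N') * A + εc :=
    abs_ratCast_le_of_norm_sub_le hF' (hcmp x₁ (by omega) τ (by omega))
  exact rat_eq_zero_of_abs_lt (hD x₁ τ) (hden x₁ τ) (lt_of_le_of_lt hφ (hfinal x₁ hx₁ τ hτ))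

/-! ### The k-step at the odd nodes (the first k-step of a level) -/

/-- **The archimedean k-step, odd nodes** (twin of `G3Setup.g3_kstep_pm_oddNodes`; Nesterenko's `𝒳_{s,0} → 𝒳_{s,1}`):
as `kstep_symm`, with the zeros `φ τ'' x = 0` at the ODD integers `|x| ≤ 2m − 1` (`m ≥ 1`), the comparison on `|x| ≤ 6m`,
the growth bound on `‖z‖ ≤ (12E+6)m`, the new points `|x₁| ≤ N′ ≤ 6m`, and the inequality
`e^{‖γ‖N′}·(2(2m)^{t+1} t (20e)^{2mt} · 2ᵗ((1+‖γ‖)Cs)ᵗ e^{‖γ‖(2m−1)} ε_c + B_G E^{−2mt}) + ε_c < 1/D x₁ τ`.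
[cite: Nesterenko2003, §4.2 Lemma 4.3 with the nodes 𝒳_{s,0}] [cite: Waldschmidt1980, Lemma 3.6] [cite: Yu2013, Lemma 5.2] -/
theorem kstep_odd (F : Tau n → ℂ → ℂ) (c : Tau n → Fin (n + 1) → ℂ)
    (hdiff : ∀ τ, Differentiable ℂ (F τ)) (hode : ∀ τ z, deriv (F τ) z = ∑ i, c τ i * F (bumpτ τ i) z)
    {Tlo : ℕ} {Cs : ℝ} (hCs1 : 1 ≤ Cs) (hc : ∀ τ, tauNorm τ < Tlo → ∑ i, ‖c τ i‖ ≤ Cs)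
    (γ : ℂ) {m N' t : ℕ} (hm : 1 ≤ m) (hN' : N' ≤ 6 * m) (ht : 1 ≤ t) {εc BG E : ℝ} (hεc0 : 0 ≤ εc) (hE : 1 ≤ E)
    (φ : Tau n → ℤ → ℚ)
    (hcmp : ∀ x : ℤ, |x| ≤ 6 * (m : ℤ) → ∀ τ' : Tau n, tauNorm τ' ≤ Tlo → ‖F τ' (x : ℂ) - ((φ τ' x : ℚ) : ℂ)‖ ≤ εc)
    (hzero : ∀ x : ℤ, Odd x → |x| ≤ 2 * (m : ℤ) - 1 → ∀ τ'' : Tau n, tauNorm τ'' < Tlo → φ τ'' x = 0)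
    (hBG : ∀ τ : Tau n, tauNorm τ + t ≤ Tlo →
      ∀ z : ℂ, ‖z‖ ≤ (12 * E + 6) * m → ‖Complex.exp (γ * z) * F τ z‖ ≤ BG)
    (D : ℤ → Tau n → ℕ) (hD : ∀ x τ, 1 ≤ D x τ) (hden : ∀ x τ, ∃ z : ℤ, (D x τ : ℚ) * φ τ x = z)
    (hfinal : ∀ x₁ : ℤ, |x₁| ≤ (N' : ℤ) → ∀ τ : Tau n, tauNorm τ + t ≤ Tlo →
      Real.exp (‖γ‖ * N') *
          (2 * ((2 * m : ℕ) : ℝ) ^ (t + 1) * t * (20 * Real.exp 1) ^ ((2 * m) * t) *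
              (2 ^ t * (((1 + ‖γ‖) * Cs) ^ t * Real.exp (‖γ‖ * (2 * m - 1)) * εc)) +
            BG * (1 / E) ^ ((2 * m) * t)) + εc < 1 / (D x₁ τ : ℝ)) :
    ∀ x₁ : ℤ, |x₁| ≤ (N' : ℤ) → ∀ τ : Tau n, tauNorm τ + t ≤ Tlo → φ τ x₁ = 0 := by
  intro x₁ hx₁ τ hτ
  have hsmall : ∀ x : ℤ, Odd x → |x| ≤ 2 * (m : ℤ) - 1 → ∀ τ'' : Tau n, tauNorm τ'' < Tlo →
      ‖F τ'' (x : ℂ)‖ ≤ εc := by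
    intro x hxo hx τ'' hτ''
    have h := hcmp x (by rw [abs_le] at hx ⊢; constructor <;> omega) τ'' hτ''.le
    rwa [hzero x hxo hx τ'' hτ'', Rat.cast_zero, sub_zero] at h
  have hx₁n : ‖((x₁ : ℤ) : ℂ)‖ ≤ 6 * m := by
    rw [Complex.norm_intCast]
    have : (|x₁| : ℝ) ≤ N' := by exact_mod_cast hx₁
    have : ((N' : ℕ) : ℝ) ≤ 6 * m := by exact_mod_cast hN'
    linarith
  have hF := norm_le_of_small_values_odd F c hdiff hode hCs1 hc γ hm ht hεc0 hE hsmall τ hτ (hBG τ hτ) hx₁n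
  set A : ℝ := 2 * ((2 * m : ℕ) : ℝ) ^ (t + 1) * t * (20 * Real.exp 1) ^ ((2 * m) * t) *
      (2 ^ t * (((1 + ‖γ‖) * Cs) ^ t * Real.exp (‖γ‖ * (2 * m - 1)) * εc)) + BG * (1 / E) ^ ((2 * m) * t) with hA
  have hA0 : 0 ≤ A := by
    have hBG0 : 0 ≤ BG := le_trans (norm_nonneg _) (hBG τ hτ 0 (by simp; positivity))
    have hCs0 : 0 ≤ Cs := le_trans zero_le_one hCs1
    positivity
  have hexp : Real.exp (‖γ‖ * ‖((x₁ : ℤ) : ℂ)‖) ≤ Real.exp (‖γ‖ * N') := by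
    refine Real.exp_le_exp.mpr (mul_le_mul_of_nonneg_left ?_ (norm_nonneg _))
    rw [Complex.norm_intCast]; exact_mod_cast hx₁
  have hF' : ‖F τ ((x₁ : ℤ) : ℂ)‖ ≤ Real.exp (‖γ‖ * N') * A :=
    hF.trans (mul_le_mul_of_nonneg_right hexp hA0)
  have hφ : |((φ τ x₁ : ℚ) : ℝ)| ≤ Real.exp (‖γ‖ * N') * A + εc :=
    abs_ratCast_le_of_norm_sub_le hF' (hcmp x₁ (by omega) τ (by omega))
  exact rat_eq_zero_of_abs_lt (hD x₁ τ) (hden x₁ τ) (lt_of_le_of_lt hφ (hfinal x₁ hx₁ τ hτ))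

end ArchKStep

end Summit.ABC.StewartYu

end
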